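import Literature.Computability.Complexity.StackFFTDriver
import Literature.Computability.Complexity.StackHarveyRegisters
import Literature.Computability.Complexity.ProductTreeHalves
import HarnessLib

/-!
# The product tree on the stack machine

Literature / complexity toolkit, continuing `StackFFTDriver.lean` (the fast negacyclic multiplier
`negMulMachine`, `runs_negMulMachine`), `StackHarveyRegisters.lean` (the outer register layer
`HReg` / `hSt`) and `ProductTreeHalves.lean` (the halves-paired product tree `ptStepH`, `ptRunH`,
`prodTreeH`, `prodTreeH_spec`).  Harvey's Algorithm 1 (arXiv:2010.05450, §4; Lemma 4) starts by
computing `∏ (x − v_i)`; here is the machine, built ONLY from verified passes of the multiplier: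
a level of the tree splits the `2h` blocks of `BF` into halves with `StackFFTLevel.segSplit`
(block `i` is paired with block `i + h`), multiplies the pairs with `negMulMachine` at exponent
`k`, and pads every product to exponent `k + 1` with the digitize pass of `StackFFTPasses.lean`
run with one chunk (`chunksPad 2^k 1 b = [b ++ 0^{2^k}]`, `chunksPad_one`):

* `ptRunH_succ'`, `ptRunH_leaves_facts` (the levels one at a time; block counts / validity);
* `ptLevel h` and **`runs_ptLevel`** (one level: `BF := encBlocks (ptStepH N k h L)`,
  `PTK := k + 1`, `X1 := h / 2`, cost `ptLevelCost n k h`), `drvInv_hBase`;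
* `ptLevelBound`, `ptLevelCost_le` (the data `h · 2^k = 2^{e+1}` is constant along the tree, so
  every level costs `O((e+3)² 2^{e+1} (n+1)³)` by `negMulMachineCost_le`, `digitCost_le`);
* `ptTree h = countLoop PTU ptLevel`, `HSlots.ptAt` and **`runs_ptTree`**: from the `2^e` leaf
  blocks `linBlock v_i` in `BF` (`PTK = 2`, `X1 = 2^{e-1}`, `PTU = 1^e`) the loop ends with
  `BF = encBlocks (prodTreeH N e vs)` — one block of exponent `e + 2` whose polynomial is
  `∏ (x − v_i)` by `prodTreeH_spec` — within `e · (ptLevelBound n e + 2) + 1` steps.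

## References

* D. Harvey, *An exponent one-fifth algorithm for deterministic integer factorisation*,
  Math. Comp. 90 (2021) 2937–2950, Lemma 2.3 (arXiv:2010.05450, Lemma 4: the product tree in
  `O(n lg³ N)`). [Harvey2021]
* J. von zur Gathen, J. Gerhard, *Modern Computer Algebra*, 3rd ed., CUP 2013, §10.1.
  (Folklore material, fully proved here.)
-/

namespace Literature.Computability.Complexity

namespace NegFFT

open _root_.Computability Polynomial

variable {N : ℕ}

/-- The levels run one at a time: `s + 1` levels are `s` levels followed by the level at exponent
`k + s` on `2^{e-s-1}` pairs. [folklore] -/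
theorem ptRunH_succ' : ∀ (s k e : ℕ) (L : List (List ℕ)), s + 1 ≤ e →
    ptRunH N k e (s + 1) L = ptStepH N (k + s) (2 ^ (e - s - 1)) (ptRunH N k e s L)
  | 0, k, e, L, _ => by simp [ptRunH]
  | s + 1, k, e, L, hs => by
    calc ptRunH N k e (s + 1 + 1) L = ptRunH N (k + 1) (e - 1) (s + 1) (ptStepH N k (2 ^ (e - 1)) L) := rfl
      _ = ptStepH N (k + 1 + s) (2 ^ (e - 1 - s - 1)) (ptRunH N (k + 1) (e - 1) s (ptStepH N k (2 ^ (e - 1)) L)) :=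
          ptRunH_succ' s (k + 1) (e - 1) _ (by omega)
      _ = ptStepH N (k + (s + 1)) (2 ^ (e - (s + 1) - 1)) (ptRunH N k e (s + 1) L) := by
          rw [show k + 1 + s = k + (s + 1) by omega, show e - 1 - s - 1 = e - (s + 1) - 1 by omega]; rfl

/-- Block count and validity after `s` levels of the halves-paired tree from the leaves. [folklore] -/
theorem ptRunH_leaves_facts (hNodd : Odd N) (hN1 : 1 < N) {e s : ℕ} (hs : s ≤ e) {vs : List ℕ} (hvs : vs.length = 2 ^ e) :
    (ptRunH N 2 e s (vs.map (linBlock (N := N)))).length = 2 ^ (e - s) ∧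
      ∀ b ∈ ptRunH N 2 e s (vs.map (linBlock (N := N))), BlockOK N (2 ^ (2 + s)) b ∧ LowHalf (2 + s) b := by
  obtain ⟨Qs, hQ, hQl, -⟩ := ptInv_ptRunH hNodd hN1 s (k := 2) (e := e) (by norm_num) hs (ptInv_leaves hN1 vs) (by rw [List.length_map, hvs])
  refine ⟨by rw [hQ.length_eq', hQl], fun b hb => ?_⟩
  obtain ⟨i, hi, rfl⟩ := List.getElem_of_mem hb
  have := List.Forall₂.get hQ hi (by rw [← hQ.length_eq']; exact hi)
  exact ⟨this.1, this.2.1⟩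

end NegFFT

open _root_.Computability SProg

namespace Com

variable {β : Type} [DecidableEq β] (h : HReg ↪ β)

section ProductTree

/-- One level of the product tree: split the `2h` blocks in `BF` into halves (`BF` := first,
`BG` := second), multiply pairwise by the fast multiplier at exponent `k` (from `PTK`), pad every
product to exponent `k + 1` by the digitize pass with one chunk, `PTK := k + 1`, `X1 := h/2`. [folklore] -/
def ptLevel : Com (EReg ⊕ β) :=
  move (Sum.inr (h (.g .BF))) (Sum.inr (h (.g (.f .IN)))) (ra .s) ;;
  ((NS.op (.copy (h .X1) (h (.g (.f .HN)))) : NS β).com ;;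
  (segSplit (rFG (rGH h)) ;;
  (move (Sum.inr (h (.g (.f .HOLD2)))) (Sum.inr (h (.g .BF))) (ra .s) ;;
  (move (Sum.inr (h (.g (.f .IN)))) (Sum.inr (h (.g .BG))) (ra .s) ;;
  ((NS.ofList [.clear (h (.g (.f .HN))), .copy (h .PTK) (h (.g .KN))] : NS β).com ;;
  (negMulMachine (rGH h) ;;
  (move (Sum.inr (h (.g .RR))) (Sum.inr (h (.g .BF))) (ra .s) ;;
  (pow2Into (rGH h) (h (.g (.f .HN))) (h .PTK) ;;
  ((NS.ofList [.copy (h (.g (.f .HN))) (h (.g (.f .M2))), .push (h (.g (.f .M2))) false, .const (h (.g (.f .T1))) [true]] : NS β).com ;;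
  (digitBF (rGH h) ;;
  (clear (Sum.inr (h (.g (.f .TW)))) ;;
  (NS.ofList [.clear (h (.g (.f .HN))), .clear (h (.g (.f .M2))), .clear (h (.g (.f .T1))), .succ (h .X2) (h .PTK), .clear (h .PTK),
    .move (h .X2) (h .PTK), .drop (h .X1)] : NS β).com)))))))))))

/-- Cost of a product-tree level on `2h` blocks at exponent `k`. [folklore] -/
def ptLevelCost (n k hh : ℕ) : ℕ :=
  120 * (hh * (2 ^ k * n)) + 60 * hh + 8 +
  (hh * (44 * (2 ^ k * (2 * n)) + 16 * n + 20) + 21 * n + 7) + negMulMachineCost n k hh +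
  (n * (16 * k + 21) + 3 * k + 7) + digitCost n (2 ^ k) 1 hh + (2 * (hh * (2 * (n + 1))) + 1) + 207 * (n + 1) ^ 3

/-- The ambient invariant is a property of the ambient file below the machine's registers. [folklore] -/
theorem drvInv_hBase {N : ℕ} (T : Regs β) (u : HSlots) : DrvInv (rGH h) N (hBase h T u) ↔ DrvInv (rGH h) N T := by
  simp only [DrvInv, rGH_apply, hBase_g]

/-- One chunk of the digitize pass pads a block by its own length of zeros. [folklore] -/
theorem chunksPad_one {m : ℕ} {b : List ℕ} (hb : b.length = m) : chunksPad m 1 b = [b ++ List.replicate m 0] := by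
  rw [chunksPad, chunksPad, List.take_of_length_le hb.le]

/-- **One level of the product tree.** [folklore] -/
theorem runs_ptLevel {N k hh n : ℕ} (hNodd : Odd N) (hN1 : 1 < N) (hn : (encodeNat N).length + 1 ≤ n) (hkn : k + 4 ≤ n) (hk : 1 ≤ k)
    (hhn : (encodeNat hh).length ≤ n) (T : Regs β) (hI : DrvInv (rGH h) N T) (hCI : T (h (.g .CINV)) = encodeNat (NegFFT.inv2N N))
    (u : HSlots) (hw : u.gw.Clean) (hsched : u.gw.sched = []) (hhist : u.gw.hist = []) (hbg : u.gw.bg = []) (hkn' : u.gw.kn = [])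
    {L : List (List ℕ)} (hL : ∀ b ∈ L, NegFFT.BlockOK N (2 ^ k) b) (hlen : L.length = 2 * hh)
    (hbf : u.gw.bf = encBlocks L) (hx1 : u.x1 = encodeNat hh) (hptk : u.ptk = encodeNat k) (hx2 : u.x2 = []) :
    Runs (ptLevel h) (base (hSt h T u))
      (base (hSt h T { u with x1 := (encodeNat hh).tail, ptk := encodeNat (k + 1), gw := { u.gw with bf := encBlocks (NegFFT.ptStepH N k hh L) } }))
      (ptLevelCost n k hh) := by
  obtain ⟨hkd, har, hlvn, hlvu, hmreg, htreg, hhn0, hm20, hm40, hlen0, htw2, htws, htw3, htmph, hout, htwout, hcc, hw0, hrr, hfz⟩ := id hw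
  have hhq : ∀ {i j : HReg}, i ≠ j → h i ≠ h j := fun hij => hq_ne h hij
  have hN : 0 < N := by omega
  set q := rGH h with hq0
  set T' := hBase h T u with hT'
  have hI' : DrvInv q N T' := (drvInv_hBase h T u).2 hI
  obtain ⟨hMD, hA, hB, hD, hF, hG, hW, hTT, hO, hS, hU, hFP, hGP, hACC, -, hL1, hL2, hDST⟩ := hI'
  set c := (n + 1) ^ 3 with hc3
  set m := 2 ^ (k - 1) with hm
  have h2m : 2 * m = 2 ^ k := by rw [hm, ← pow_succ']; congr 1; omega
  have hLm : ∀ b ∈ L, b.length = 2 * m ∧ ∀ a ∈ b, a < N := fun b hb => ⟨by rw [h2m]; exact (hL b hb).1, (hL b hb).2⟩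
  set A := L.take hh with hA0
  set Bk := L.drop hh with hB0
  have hlA : A.length = hh := by rw [hA0, List.length_take, hlen]; omega
  have hlB : Bk.length = hh := by rw [hB0, List.length_drop, hlen]; omega
  have hAv : ∀ b ∈ A, NegFFT.BlockOK N (2 ^ k) b := fun b hb => hL b (List.mem_of_mem_take hb)
  have hBv : ∀ b ∈ Bk, NegFFT.BlockOK N (2 ^ k) b := fun b hb => hL b (List.mem_of_mem_drop hb)
  set P := List.zipWith (NegFFT.negMulRec N k) A Bk with hP0
  have hlP : P.length = hh := by rw [hP0, List.length_zipWith, hlA, hlB, min_self]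
  have hPv : ∀ b ∈ P, NegFFT.BlockOK N (2 ^ k) b := fun b hb => by
    obtain ⟨f, hf, g, hg, rfl⟩ := exists_mem_of_mem_zipWith hb
    exact (NegFFT.negMulRec_spec hNodd hN1 k (hAv f hf) (hBv g hg)).1
  -- sizes
  have hlk : (encodeNat k).length ≤ n := (length_encodeNat_le_succ (le_two_pow_self k)).trans (by omega)
  have hl2k : (encodeNat (2 ^ k)).length ≤ n := by rw [encodeNat_two_pow]; simp; omega
  have hl2k1 : (encodeNat (2 * 2 ^ k)).length + 1 ≤ n := by rw [← pow_succ', encodeNat_two_pow]; simp; omega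
  have e2k1 : encodeNat (2 * 2 ^ k) = false :: encodeNat (2 ^ k) := encodeNat_two_mul _ (Nat.two_pow_pos k)
  have e1 : encodeNat 1 = [true] := by simpa using encodeNat_two_pow 0
  have hlinL : (encBlocks L).length ≤ 2 * hh * (2 * (2 * m * (2 * n)) + 2) := by
    have := length_encBlocks_le (m := m) hn hLm; rwa [hlen] at this
  rw [h2m] at hlinL
  have hlinA : (encBlocks A).length ≤ hh * (2 * (2 * m * (2 * n)) + 2) := by
    have := length_encBlocks_le (m := m) (Bs := A) hn (fun b hb => hLm b (List.mem_of_mem_take hb)); rwa [hlA] at this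
  rw [h2m] at hlinA
  have hlinB : (encBlocks Bk).length ≤ hh * (2 * (2 * m * (2 * n)) + 2) := by
    have := length_encBlocks_le (m := m) (Bs := Bk) hn (fun b hb => hLm b (List.mem_of_mem_drop hb)); rwa [hlB] at this
  rw [h2m] at hlinB
  have hPm : ∀ b ∈ P, b.length = 2 * m ∧ ∀ a ∈ b, a < N := fun b hb => ⟨by rw [h2m]; exact (hPv b hb).1, (hPv b hb).2⟩
  have hlinP : (encBlocks P).length ≤ hh * (2 * (2 * m * (2 * n)) + 2) := by
    have := length_encBlocks_le (m := m) (Bs := P) hn hPm; rwa [hlP] at this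
  rw [h2m] at hlinP
  -- reading the machine's own registers through the multiplier's state function
  have rX1 : ∀ w : GSlots, gSt q T' w (h .X1) = encodeNat hh := fun w => by
    rw [hq0, gSt_of_ne _ _ _ (rGH_ne h .X1 (fun _ e => HReg.noConfusion e)), hT', hBase_X1, hx1]
  have rPTK : ∀ w : GSlots, gSt q T' w (h .PTK) = encodeNat k := fun w => by
    rw [hq0, gSt_of_ne _ _ _ (rGH_ne h .PTK (fun _ e => HReg.noConfusion e)), hT', hBase_PTK, hptk]
  have rX2 : ∀ w : GSlots, gSt q T' w (h .X2) = [] := fun w => by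
    rw [hq0, gSt_of_ne _ _ _ (rGH_ne h .X2 (fun _ e => HReg.noConfusion e)), hT', hBase_X2, hx2]
  -- records (multiplier level)
  let e16 : FSlots := ⟨[], [], [], [], [], [], [], [], [], [], [], [], [], [], [], []⟩
  let g0 : GSlots := u.gw
  let g1 : GSlots := { g0 with bf := [], fz := { e16 with inp := encBlocks L } }
  let g2 : GSlots := { g1 with hn := encodeNat hh }
  let g3 : GSlots := { g2 with fz := { e16 with inp := encBlocks Bk, hold2 := encBlocks A } }
  let g4 : GSlots := { g2 with bf := encBlocks A, fz := { e16 with inp := encBlocks Bk } }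
  let g5 : GSlots := { g2 with bf := encBlocks A, bg := encBlocks Bk, fz := e16 }
  let g6 : GSlots := { g0 with kn := encodeNat k, bf := encBlocks A, bg := encBlocks Bk }
  let g7 : GSlots := { g0 with kn := [], bf := [], bg := [], rr := encBlocks P }
  have hst0 : hSt h T u = gSt q T' g0 := rfl
  have h1 : Runs (move (Sum.inr (h (.g .BF))) (Sum.inr (h (.g (.f .IN)))) (ra .s)) (base (gSt q T' g0)) (base (gSt q T' g1))
      (6 * (2 * hh * (2 * (2 ^ k * (2 * n)) + 2)) + 2) := by
    refine (runs_omove (a := q .BF) (b := q (.f .IN)) (gq_ne q (by decide)) (gSt q T' g0)).of_eq ?_ ?_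
    · simp [g0, g1, e16, hbf, hfz]
    · simp only [gSt_BF, g0, hbf]; omega
  have h2 : Runs (NS.op (.copy (h .X1) (h (.g (.f .HN)))) : NS β).com (base (gSt q T' g1)) (base (gSt q T' g2)) (13 * c) :=
    NS.runs_of_eq (N := n) _ _ (by simp [NOp.ok, rX1, hhn, hhq]) (by
      have : (q (.f .HN)) = h (.g (.f .HN)) := rfl
      simp [g1, g2, g0, rX1, ← this, hhn0]) (by simp [hc3])
  have h3 : Runs (segSplit (rFG q)) (base (gSt q T' g2)) (base (gSt q T' g3)) (hh * (44 * (2 ^ k * (2 * n)) + 16 * n + 20) + 21 * n + 7) := by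
    have hr := runs_segSplit (rFG q) (m := m) hn hhn (gBase q T' g2) (by simp [g2]) (by rw [rFG_apply, gBase_v q _ _ (by decide) (by decide)]; exact hW)
      (by rw [rFG_apply, gBase_v q _ _ (by decide) (by decide)]; exact hTT) g2.fz (us := A) (rest := Bk)
      (fun b hb => hLm b (List.mem_of_mem_take hb)) hlA (by simp [g2, g1, hA0, hB0, List.take_append_drop]) (by simp [g2, g1, e16])
      (by simp [g2, g1, e16]) (by simp [g2, g1, e16]) (by simp [g2, g1, e16])
    rw [h2m] at hr
    exact hr.of_eq (by simp only [fSt_gBase, g2, g3, g1, e16]) le_rfl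
  have h4 : Runs (move (Sum.inr (h (.g (.f .HOLD2)))) (Sum.inr (h (.g .BF))) (ra .s)) (base (gSt q T' g3)) (base (gSt q T' g4))
      (6 * (hh * (2 * (2 ^ k * (2 * n)) + 2)) + 2) := by
    refine (runs_omove (a := q (.f .HOLD2)) (b := q .BF) (gq_ne q (by decide)) (gSt q T' g3)).of_eq ?_ ?_
    · simp [g3, g4, g2, g1, e16]
    · simp only [gSt_sHOLD2, g3, e16]; omega
  have h5 : Runs (move (Sum.inr (h (.g (.f .IN)))) (Sum.inr (h (.g .BG))) (ra .s)) (base (gSt q T' g4)) (base (gSt q T' g5))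
      (6 * (hh * (2 * (2 ^ k * (2 * n)) + 2)) + 2) := by
    refine (runs_omove (a := q (.f .IN)) (b := q .BG) (gq_ne q (by decide)) (gSt q T' g4)).of_eq ?_ ?_
    · simp [g4, g5, g2, g1, g0, e16, hbg]
    · simp only [gSt_sIN, g4, e16]; omega
  have h6 : Runs (NS.ofList [.clear (h (.g (.f .HN))), .copy (h .PTK) (h (.g .KN))] : NS β).com (base (gSt q T' g5)) (base (gSt q T' g6)) (16 * c) := by
    refine NS.runs_of_eq (N := n) _ _ ?_ ?_ (by simp [hc3])
    · have e1' : (q (.f .HN)) = h (.g (.f .HN)) := rfl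
      have e2' : (q .KN) = h (.g .KN) := rfl
      simp only [NS.ofList, NS.ok, NOp.ok, NS.eval, NOp.eval, ← e1', ← e2', gSt_fHN, update_gSt_fHN, rPTK, g5, g2, g1, g0, hkn', ne_eq]
      exact ⟨hhn, ⟨hhq (by decide), hlk⟩, trivial⟩
    · have e1' : (q (.f .HN)) = h (.g (.f .HN)) := rfl
      have e2' : (q .KN) = h (.g .KN) := rfl
      simp [← e1', ← e2', g5, g6, g2, g1, g0, rPTK, hkn', hhn0, hfz, e16]
  have h7 : Runs (negMulMachine q) (base (gSt q T' g6)) (base (gSt q T' g7)) (negMulMachineCost n k hh) := by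
    have hr := runs_negMulMachine q hN1 hn hkn T' ⟨hMD, hA, hB, hD, hF, hG, hW, hTT, hO, hS, hU, hFP, hGP, hACC, by
      rw [hT', rGH_apply, hBase_g]; exact ((drvInv_hBase h T u).1 ((drvInv_hBase h T u).2 hI)).2.2.2.2.2.2.2.2.2.2.2.2.2.2.1, hL1, hL2, hDST⟩
      (by rw [hT', rGH_apply, hBase_g, hCI]) g0 hw hsched hhist hAv hBv (by rw [hlA, hlB])
    rw [hlA] at hr
    exact hr.of_eq (by simp only [g7, g0, hP0]) le_rfl
  -- pad by the digitize pass with one chunk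
  let g8 : GSlots := { g0 with kn := [], bf := encBlocks P, bg := [] }
  let g9 : GSlots := { g8 with hn := encodeNat (2 ^ k) }
  let g10 : GSlots := { g9 with m2 := encodeNat (2 * 2 ^ k), fz := { e16 with t1 := encodeNat 1 } }
  let g11 : GSlots := { g10 with bf := encBlocks (P.flatMap (chunksPad (2 ^ k) 1)), fz := { e16 with t1 := encodeNat 1, tw := encVec (List.replicate hh (2 * 2 ^ k)) } }
  let g12 : GSlots := { g10 with bf := encBlocks (P.flatMap (chunksPad (2 ^ k) 1)) }
  let g13 : GSlots := { g0 with kn := [], bg := [], bf := encBlocks (P.flatMap (chunksPad (2 ^ k) 1)) }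
  have h8 : Runs (move (Sum.inr (h (.g .RR))) (Sum.inr (h (.g .BF))) (ra .s)) (base (gSt q T' g7)) (base (gSt q T' g8))
      (6 * (hh * (2 * (2 ^ k * (2 * n)) + 2)) + 2) := by
    refine (runs_omove (a := q .RR) (b := q .BF) (gq_ne q (by decide)) (gSt q T' g7)).of_eq ?_ ?_
    · simp [g7, g8, g0, hrr]
    · simp only [gSt_RR, g7]; omega
  have h9 : Runs (pow2Into q (h (.g (.f .HN))) (h .PTK)) (base (gSt q T' g8)) (base (gSt q T' g9)) (n * (16 * k + 21) + 3 * k + 7) := by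
    have e1' : (q (.f .HN)) = h (.g (.f .HN)) := rfl
    refine (runs_pow2Into q (dst := h (.g (.f .HN))) (src := h .PTK) (hhq (by decide)) (hhq (by decide)) hlk (gSt q T' g8) (rPTK g8)
      (by rw [← e1', gSt_fHN]; simp [g8, g0, hhn0]) (by rw [gSt_v q _ _ (by decide) (by decide) (by decide) (by decide) (by decide) (by decide)]; exact hU)).of_eq ?_ le_rfl
    rw [← e1', update_gSt_fHN]
  have h10 : Runs (NS.ofList [.copy (h (.g (.f .HN))) (h (.g (.f .M2))), .push (h (.g (.f .M2))) false, .const (h (.g (.f .T1))) [true]] : NS β).com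
      (base (gSt q T' g9)) (base (gSt q T' g10)) (18 * c) := by
    have e1' : (q (.f .HN)) = h (.g (.f .HN)) := rfl
    have e2' : (q (.f .M2)) = h (.g (.f .M2)) := rfl
    have e3' : (q (.f .T1)) = h (.g (.f .T1)) := rfl
    refine NS.runs_of_eq (N := n) _ _ ?_ ?_ (by simp [hc3])
    · simp only [NS.ofList, NS.ok, NOp.ok, NS.eval, NOp.eval, ← e1', ← e2', ← e3', gSt_fHN, gSt_fM2, gSt_sT1, update_gSt_fM2, g9, g8, g0, hm20, hfz, ne_eq,
        List.length_nil, List.append_nil, EmbeddingLike.apply_eq_iff_eq]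
      exact ⟨⟨by decide, hl2k⟩, trivial, ⟨by omega, by simp; omega⟩, trivial⟩
    · simp [← e1', ← e2', ← e3', g9, g10, g8, g0, hm20, hfz, e16, e2k1, e1]
  have hPd : ∀ b ∈ P, (∀ a ∈ b, a < N) ∧ b.length = 2 ^ k * 1 := fun b hb => ⟨(hPv b hb).2, by rw [mul_one]; exact (hPv b hb).1⟩
  have h11 : Runs (digitBF q) (base (gSt q T' g10)) (base (gSt q T' g11)) (digitCost n (2 ^ k) 1 hh) := by
    have hl1 : (encodeNat 1).length ≤ n := by rw [e1]; simp only [List.length_cons, List.length_nil]; omega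
    have hr := runs_digitBF q hn hl2k hl2k1 (t := 1) hl1 T' ⟨hMD, hA, hB, hD, hF, hG, hW, hTT, hO, hS, hU, hFP, hGP, hACC, by
      rw [hT', rGH_apply, hBase_g]; exact ((drvInv_hBase h T u).1 ((drvInv_hBase h T u).2 hI)).2.2.2.2.2.2.2.2.2.2.2.2.2.2.1, hL1, hL2, hDST⟩ g10 hPd
      (by simp [g10, g9, g8]) (by simp [g10, g9]) (by simp [g10]) (by simp [g10, g9, g8, g0, hout]) (by simp [g10, g9, g8, g0, htwout]) [] [] [] [] [] [] [] (by simp [g10, e16])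
    rw [hlP] at hr
    exact hr.of_eq (by simp only [g10, g11, e16]) le_rfl
  have hltw : (encVec (List.replicate hh (2 * 2 ^ k))).length ≤ hh * (2 * (n + 1)) := by
    have : ∀ x ∈ List.replicate hh (2 * 2 ^ k), x < 2 * 2 ^ k + 1 := fun x hx => by rw [List.eq_of_mem_replicate hx]; omega
    have h2k0 := Nat.two_pow_pos k
    have h8' : (encodeNat (2 * 2 ^ k + 1)).length + 1 ≤ n + 1 :=
      Nat.succ_le_succ ((length_encodeNat_le_succ (show 2 * 2 ^ k + 1 ≤ 2 ^ (k + 2) by rw [pow_succ, pow_succ]; omega)).trans (by omega))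
    have := length_encVec_le_of_lt this h8'; rwa [List.length_replicate] at this
  have h12 : Runs (clear (Sum.inr (h (.g (.f .TW))))) (base (gSt q T' g11)) (base (gSt q T' g12)) (2 * (hh * (2 * (n + 1))) + 1) := by
    have e1' : (q (.f .TW)) = h (.g (.f .TW)) := rfl
    refine (runs_clear (Sum.inr (h (.g (.f .TW)))) (base (gSt q T' g11))).of_eq (by rw [← e1']; simp [g11, g12, g10, e16]) ?_
    change 2 * (gSt q T' g11 (h (.g (.f .TW)))).length + 1 ≤ _
    rw [← e1', gSt_sTW]; simp only [g11]; omega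
  have h13 : Runs (NS.ofList [.clear (h (.g (.f .HN))), .clear (h (.g (.f .M2))), .clear (h (.g (.f .T1))), .succ (h .X2) (h .PTK), .clear (h .PTK),
      .move (h .X2) (h .PTK), .drop (h .X1)] : NS β).com (base (gSt q T' g12))
      (base (hSt h T { u with x1 := (encodeNat hh).tail, ptk := encodeNat (k + 1), gw := { u.gw with bf := encBlocks (NegFFT.ptStepH N k hh L) } })) (160 * c) := by
    have e1' : (q (.f .HN)) = h (.g (.f .HN)) := rfl
    have e2' : (q (.f .M2)) = h (.g (.f .M2)) := rfl
    have e3' : (q (.f .T1)) = h (.g (.f .T1)) := rfl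
    have rdG : ∀ (c : HReg) (hc : ∀ y, c ≠ .g y) (T'' : Regs β) (w : GSlots), gSt q T'' w (h c) = T'' (h c) := fun c hc T'' w => by
      rw [hq0, gSt_of_ne _ _ _ (rGH_ne h c hc)]
    have wrG : ∀ (c : HReg) (hc : ∀ y, c ≠ .g y) (T'' : Regs β) (w : GSlots) (v : List Bool),
        Function.update (gSt q T'' w) (h c) v = gSt q (Function.update T'' (h c) v) w := fun c hc T'' w v => by
      rw [hq0, update_gSt_of_ne _ _ _ (rGH_ne h c hc)]
    have nX2 : ∀ y, HReg.X2 ≠ .g y := fun _ e => HReg.noConfusion e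
    have nX1 : ∀ y, HReg.X1 ≠ .g y := fun _ e => HReg.noConfusion e
    have nPTK : ∀ y, HReg.PTK ≠ .g y := fun _ e => HReg.noConfusion e
    refine NS.runs_of_eq (N := n) _ _ ?_ ?_ (by simp [hc3])
    · simp only [NS.ofList, NS.ok, NOp.ok, NS.eval, NOp.eval, ← e1', ← e2', ← e3', gSt_fHN, gSt_fM2, gSt_sT1, update_gSt_fHN, update_gSt_fM2, update_gSt_sT1,
        rdG .X2 nX2, rdG .PTK nPTK, wrG .X2 nX2, wrG .PTK nPTK, hT', hBase_X2, hBase_PTK, update_hBase_X2, update_hBase_PTK,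
        hx2, hptk, g12, g10, g9, ne_eq, List.length_nil, EmbeddingLike.apply_eq_iff_eq, e1, List.length_cons, bitsToNat_encodeNat]
      exact ⟨hl2k, by omega, by omega, ⟨hlk, by omega⟩, hlk, ⟨by decide, (length_encodeNat_le_succ (le_two_pow_self _)).trans (by omega)⟩, trivial, trivial⟩
    · have padAll : ∀ P' : List (List ℕ), (∀ b ∈ P', b.length = 2 ^ k) →
          P'.flatMap (chunksPad (2 ^ k) 1) = P'.map (fun b => b ++ List.replicate (2 ^ k) 0) := by
        intro P' hP'
        induction P' with
        | nil => rfl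
        | cons b P' ih =>
          rw [List.flatMap_cons, List.map_cons, chunksPad_one (hP' b (by simp)), ih (fun b' hb' => hP' b' (by simp [hb']))]; rfl
      have ePad : P.flatMap (chunksPad (2 ^ k) 1) = NegFFT.ptStepH N k hh L := by
        rw [padAll P (fun b hb => (hPv b hb).1), NegFFT.ptStepH, ← hA0, ← hB0, ← hP0]
      simp only [NS.ofList, NS.eval, NOp.eval, ← e1', ← e2', ← e3', update_gSt_fHN, update_gSt_fM2, update_gSt_sT1,
        rdG .X2 nX2, rdG .PTK nPTK, rdG .X1 nX1, wrG .X2 nX2, wrG .PTK nPTK, wrG .X1 nX1, hT', hBase_X2, hBase_PTK, hBase_X1, update_hBase_X2, update_hBase_PTK,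
        update_hBase_X1, hx2, hptk, hx1, g12, g10, g9, g8, g0, bitsToNat_encodeNat, Function.update_self,
        Function.update_of_ne (hhq (show HReg.X1 ≠ HReg.PTK by decide)), ePad, hSt, hbg, hkn', hhn0, hm20, hfz, e16, hrr, List.append_nil]
      rfl
  refine (h1.seq (h2.seq (h3.seq (h4.seq (h5.seq (h6.seq (h7.seq (h8.seq (h9.seq (h10.seq (h11.seq (h12.seq h13)))))))))))).of_eq rfl ?_
  unfold ptLevelCost
  have e5 : 2 * hh * (2 * (2 ^ k * (2 * n)) + 2) = 8 * (hh * (2 ^ k * n)) + 4 * hh := by ring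
  have e6 : hh * (2 * (2 ^ k * (2 * n)) + 2) = 4 * (hh * (2 ^ k * n)) + 2 * hh := by ring
  rw [e5] at h1; rw [e6] at h4 h5 h8
  omega

end ProductTree

/-! ### The tree loop -/

section TreeLoop

/-- The product-tree loop: one `ptLevel` per token of `PTU`. [folklore] -/
def ptTree : Com (EReg ⊕ β) := countLoop (Sum.inr (h .PTU)) (ptLevel h)

/-- A uniform bound for the level costs of a tree with `2^e` leaves. [folklore] -/
def ptLevelBound (n e : ℕ) : ℕ := 300000 * ((e + 3) ^ 2 * (2 ^ (e + 1) * (n + 1) ^ 3))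

/-- The level costs are uniformly bounded along the tree. [folklore] -/
theorem ptLevelCost_le {n e j : ℕ} (hj : j < e) (hen : e + 2 ≤ n) :
    ptLevelCost n (2 + j) (2 ^ (e - j - 1)) ≤ ptLevelBound n e := by
  set k := 2 + j with hk
  set hh := 2 ^ (e - j - 1) with hhh
  set c := (n + 1) ^ 3 with hc3
  set D := 2 ^ (e + 1) with hD
  have hdata : hh * 2 ^ k = D := by rw [hhh, hk, hD, ← pow_add]; congr 1; omega
  have h2k : 2 ^ k ≤ D := by rw [hk, hD]; exact Nat.pow_le_pow_right (by norm_num) (by omega)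
  have hh1 : 1 ≤ hh := Nat.one_le_two_pow
  have hhD : hh ≤ D := by rw [← hdata]; exact Nat.le_mul_of_pos_right _ (Nat.two_pow_pos _)
  have hc1 : 1 ≤ c := Nat.one_le_pow _ _ (by omega)
  have hnc : n ≤ c := le_cube_succ n
  have hD1 : 1 ≤ D := Nat.one_le_two_pow
  set W := D * c with hW
  have hW1 : 1 ≤ W := Nat.one_le_iff_ne_zero.2 (Nat.mul_ne_zero (by omega) (by omega))
  -- the multiplier
  have hm := negMulMachineCost_le n k hh
  have hk3 : k + 1 ≤ e + 3 := by omega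
  have hmul : negMulMachineCost n k hh ≤ 100000 * ((e + 3) ^ 2 * (2 * W)) := by
    refine hm.trans (Nat.mul_le_mul_left _ (Nat.mul_le_mul (Nat.pow_le_pow_left hk3 2) ?_))
    rw [hW, show 2 * (D * c) = (D + D) * c by ring]
    refine Nat.mul_le_mul_right _ ?_
    calc (hh + 1) * 2 ^ k = hh * 2 ^ k + 2 ^ k := by ring
      _ ≤ D + D := by rw [hdata]; exact Nat.add_le_add_left h2k _
  -- the digitize pad
  have hdg : digitCost n (2 ^ k) 1 hh ≤ 534 * (2 * W) := by
    refine (digitCost_le (n := n) (B := hh) (k := k) (mul_one _) (Nat.one_le_two_pow)).trans ?_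
    rw [hW, show 2 * (D * c) = (D + D) * c by ring]
    refine Nat.mul_le_mul_left _ (Nat.mul_le_mul_right _ ?_)
    calc (hh + 1) * 2 ^ k = hh * 2 ^ k + 2 ^ k := by ring
      _ ≤ D + D := by rw [hdata]; exact Nat.add_le_add_left h2k _
  -- the linear terms
  have h1 : hh * (2 ^ k * n) ≤ W := by rw [hW, ← mul_assoc, hdata]; exact Nat.mul_le_mul_left _ hnc
  have h2 : hh * (2 ^ k * (2 * n)) ≤ 2 * W := by
    rw [show hh * (2 ^ k * (2 * n)) = 2 * (hh * (2 ^ k * n)) by ring]; exact Nat.mul_le_mul_left _ h1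
  have h3 : hh * n ≤ W := by rw [hW]; exact Nat.mul_le_mul hhD hnc
  have h4 : hh ≤ W := by rw [hW]; exact hhD.trans (Nat.le_mul_of_pos_right _ (by omega))
  have h5 : n ≤ W := by rw [hW]; exact hnc.trans (Nat.le_mul_of_pos_left _ (by omega))
  have h6 : n * k ≤ (e + 3) * W := by rw [mul_comm]; exact Nat.mul_le_mul (by omega) h5
  have h7 : k ≤ (e + 3) * W := (show k ≤ e + 3 by omega).trans (Nat.le_mul_of_pos_right _ (by omega))
  have h8 : c ≤ W := by rw [hW]; exact Nat.le_mul_of_pos_left _ (by omega)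
  have he1 : 1 ≤ (e + 3) ^ 2 := Nat.one_le_pow _ _ (by omega)
  have heW : W ≤ (e + 3) ^ 2 * W := Nat.le_mul_of_pos_left _ (by omega)
  have heW' : (e + 3) * W ≤ (e + 3) ^ 2 * W := Nat.mul_le_mul_right _ (by nlinarith)
  unfold ptLevelCost ptLevelBound
  rw [← hc3, ← hD, ← hW]
  linarith [hmul, hdg, h1, h2, h3, h4, h5, h6, h7, h8, heW, heW', hW1]

/-- Halving the power numeral. [folklore] -/
theorem tail_encodeNat_two_pow_succ (i : ℕ) : (encodeNat (2 ^ (i + 1))).tail = encodeNat (2 ^ i) := by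
  rw [pow_succ, mul_comm, encodeNat_two_mul _ (Nat.two_pow_pos i)]; rfl

/-- Cleanliness does not look at the operand batch. [folklore] -/
theorem GSlots.Clean.with_bf {w : GSlots} (hw : w.Clean) (x : List Bool) : ({ w with bf := x } : GSlots).Clean := by
  unfold GSlots.Clean at hw ⊢; simpa using hw

/-- The machine state with `kc` levels of the tree still to run. [folklore] -/
def HSlots.ptAt (u : HSlots) (N e : ℕ) (vs : List ℕ) (kc : ℕ) : HSlots :=
  { u with x1 := (encodeNat (2 ^ kc)).tail, ptk := encodeNat (2 + (e - kc)), ptu := List.replicate kc true, gw := { u.gw with bf := encBlocks (NegFFT.ptRunH N 2 e (e - kc) (vs.map (NegFFT.linBlock (N := N)))) } }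

/-- **The product tree on the machine**: from the `2^e` leaf blocks in `BF`, `PTK = 2`, `X1 = 2^{e-1}`
(as `(encodeNat 2^e).tail`), `PTU = 1^e`, the loop ends with `BF = encBlocks (prodTreeH N e vs)` — one
block whose polynomial is `∏ (x − v_i)` (`prodTreeH_spec`). [folklore] -/
theorem runs_ptTree {N e n : ℕ} (hNodd : Odd N) (hN1 : 1 < N) (hn : (encodeNat N).length + 1 ≤ n) (hen : e + 6 ≤ n)
    (T : Regs β) (hI : DrvInv (rGH h) N T) (hCI : T (h (.g .CINV)) = encodeNat (NegFFT.inv2N N))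
    (u : HSlots) (hw : u.gw.Clean) (hsched : u.gw.sched = []) (hhist : u.gw.hist = []) (hbg : u.gw.bg = []) (hkn' : u.gw.kn = [])
    {vs : List ℕ} (hvs : vs.length = 2 ^ e) (hbf : u.gw.bf = encBlocks (vs.map (NegFFT.linBlock (N := N))))
    (hx1 : u.x1 = (encodeNat (2 ^ e)).tail) (hptk : u.ptk = encodeNat 2) (hx2 : u.x2 = []) (hptu : u.ptu = List.replicate e true) :
    Runs (ptTree h) (base (hSt h T u))
      (base (hSt h T { u with x1 := [], ptk := encodeNat (2 + e), ptu := [], gw := { u.gw with bf := encBlocks (NegFFT.prodTreeH N e vs) } }))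
      (e * (ptLevelBound n e + 2) + 1) := by
  set L0 := vs.map (NegFFT.linBlock (N := N)) with hL0
  have hstart : u = u.ptAt N e vs e := by
    rcases u with ⟨⟩; rename_i gw; rcases gw with ⟨⟩
    simp only [HSlots.ptAt, Nat.sub_self, NegFFT.ptRunH] at *
    simp [hx1, hptk, hptu, hbf, hL0]
  have hloop := runs_countLoop (U := (Sum.inr (h .PTU) : EReg ⊕ β)) (body := ptLevel h)
    (fun kc R => kc ≤ e ∧ R = base (hSt h T (u.ptAt N e vs kc))) (ptLevelBound n e)
    (by
      rintro kc R ⟨hkc, rfl⟩ -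
      set j := e - (kc + 1) with hj
      obtain ⟨hlenj, hvalj⟩ := NegFFT.ptRunH_leaves_facts (N := N) hNodd hN1 (s := j) (by omega) hvs
      have hr := runs_ptLevel h hNodd hN1 hn (k := 2 + j) (hh := 2 ^ kc) (by omega) (by omega)
        (by rw [encodeNat_two_pow]; simp; omega) T hI hCI { u.ptAt N e vs (kc + 1) with ptu := List.replicate kc true }
        (hw.with_bf _) hsched hhist hbg hkn' (L := NegFFT.ptRunH N 2 e j L0) (fun b hb => (hvalj b hb).1)
        (by rw [hlenj, show e - j = kc + 1 by omega, pow_succ]; ring) rfl (by simp [HSlots.ptAt, tail_encodeNat_two_pow_succ]) (by simp [HSlots.ptAt, hj])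
        (by simp [HSlots.ptAt, hx2])
      have hc := ptLevelCost_le (n := n) (e := e) (j := j) (by omega) (by omega)
      rw [show e - j - 1 = kc by omega] at hc
      have e3 : Function.update (base (hSt h T (u.ptAt N e vs (kc + 1)))) (Sum.inr (h .PTU)) (List.replicate kc true) =
          base (hSt h T { u.ptAt N e vs (kc + 1) with ptu := List.replicate kc true }) := by simp
      rw [e3]
      have eK : 2 + j + 1 = 2 + (e - kc) := by omega
      have eR : NegFFT.ptStepH N (2 + j) (2 ^ kc) (NegFFT.ptRunH N 2 e j (vs.map (NegFFT.linBlock (N := N)))) =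
          NegFFT.ptRunH N 2 e (e - kc) (vs.map (NegFFT.linBlock (N := N))) := by
        rw [show e - kc = j + 1 by omega, NegFFT.ptRunH_succ' j 2 e _ (by omega), show e - j - 1 = kc by omega]
      refine ⟨_, hr.of_eq (by simp only [HSlots.ptAt, eK, hL0, eR]) hc, by simp [HSlots.ptAt], by omega, rfl⟩)
    e (base (hSt h T (u.ptAt N e vs e))) ⟨le_rfl, rfl⟩ (by simp [HSlots.ptAt])
  obtain ⟨R', hL, -, -, rfl⟩ := hloop
  rw [← hstart] at hL
  refine hL.of_eq ?_ le_rfl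
  simp only [HSlots.ptAt, Nat.sub_zero, pow_zero, NegFFT.prodTreeH]
  rfl

end TreeLoop

end Com

end Literature.Computability.Complexity
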